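import Literature.Geometry.Euclidean.AlmostIsometryNearIsometry
import Mathlib.Topology.MetricSpace.Isometry
import HarnessLib

/-!
# Gromov–Hausdorff charts into `ℝⁿ` are unique up to an almost rigid motion

The first lemma of Reifenberg-type constructions (Cheeger–Colding 1997, Appendix 1, proof of
Thm. A.1.2/A.1.3; Reifenberg 1960; Cheeger, *Degeneration of Riemannian metrics under Ricci
curvature bounds*, Thm. 10.x "transition maps between GH charts are close to isometries"): if two
maps `φ₁, φ₂` from a set `S` of a (pseudo)metric space into `ℝⁿ` are both `δ`-almost isometries
on `S`, `|‖φᵢ x − φᵢ y‖ − d(x, y)| ≤ δ`, and the image of `φ₁` is `δ`-dense in the closed ball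
`B̄_r(0)` (this is the data of two `δ`-Gromov–Hausdorff approximations `S → B̄_r(0)`), then
`φ₂ = A ∘ φ₁ + O(C(n) δ)` on `{x ∈ S : ‖φ₁ x‖ ≤ r}` for an AFFINE ISOMETRY `A` of `ℝⁿ`:

  `‖φ₂ x − (c + A (φ₁ x))‖ ≤ (3 + 4 K(n)) δ`,  `K(n) = n (6 + 11 (7n)ⁿ)`

(`exists_linearIsometryEquiv_comp_near_of_ghApprox`), provided `4δ ≤ r/(12 (7n)ⁿ)`: the
composite `φ₂ ∘ φ₁⁻¹` (any choice of approximate preimages) is a `4δ`-isometry of `B̄_r(0)`,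
hence `C(n)δ`-close to an affine isometry (`exists_linearIsometryEquiv_near_of_abs_norm_sub_le_of_radius`).

No definitions, no named facts (D-0026). Groundwork for `CheegerColding1997_sphereStability`
(block (I): intrinsic Reifenberg theorem).

## References

* J. Cheeger, T. H. Colding, J. Differential Geom. 46 (1997) 406–480, App. 1, Thm. A.1.2.
  [CheegerColding1997]
* E. R. Reifenberg, Acta Math. 104 (1960) 1–92, Lemma 3 ff.
-/

noncomputable section

open Set Metric

namespace Literature.Geometry.Euclidean

/-- **Two GH charts differ by an almost rigid motion.** Let `S` be a set in a pseudometric space,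
`φ₁ φ₂ : X → ℝⁿ` with `|‖φᵢ x − φᵢ y‖ − d(x,y)| ≤ δ` for `x, y ∈ S` (`i = 1, 2`), and suppose every
point of the closed ball `‖v‖ ≤ r` is within `δ` of some `φ₁ x`, `x ∈ S`. If
`4δ ≤ r/(12(7n)ⁿ)`, there are `c ∈ ℝⁿ` and a linear isometry `A` with
`‖φ₂ x − (c + A (φ₁ x))‖ ≤ (3 + 4 n (6 + 11 (7n)ⁿ)) δ` for all `x ∈ S` with `‖φ₁ x‖ ≤ r`.
[cite: CheegerColding1997, App. 1, proof of Thm. A.1.2] -/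
theorem exists_linearIsometryEquiv_comp_near_of_ghApprox (n : ℕ) {X : Type*}
    [PseudoMetricSpace X] {S : Set X} {φ₁ φ₂ : X → EuclideanSpace ℝ (Fin n)} {δ r : ℝ}
    (hr : 0 < r) (hδ0 : 0 ≤ δ) (hδ : 4 * δ ≤ r / (12 * (7 * n : ℝ) ^ n))
    (h₁ : ∀ x ∈ S, ∀ y ∈ S, |‖φ₁ x - φ₁ y‖ - dist x y| ≤ δ)
    (h₂ : ∀ x ∈ S, ∀ y ∈ S, |‖φ₂ x - φ₂ y‖ - dist x y| ≤ δ)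
    (hdense : ∀ v : EuclideanSpace ℝ (Fin n), ‖v‖ ≤ r → ∃ x ∈ S, ‖φ₁ x - v‖ ≤ δ) :
    ∃ (c : EuclideanSpace ℝ (Fin n)) (A : EuclideanSpace ℝ (Fin n) ≃ₗᵢ[ℝ] EuclideanSpace ℝ (Fin n)),
      ∀ x ∈ S, ‖φ₁ x‖ ≤ r →
        ‖φ₂ x - (c + A (φ₁ x))‖ ≤ (3 + 4 * (n * (6 + 11 * (7 * n : ℝ) ^ n))) * δ := by
  classical
  -- approximate preimages `ψ v ∈ S` with `‖φ₁ (ψ v) - v‖ ≤ δ` on the ball (junk elsewhere)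
  have hch : ∀ v : EuclideanSpace ℝ (Fin n), ∃ x : X, ‖v‖ ≤ r → x ∈ S ∧ ‖φ₁ x - v‖ ≤ δ := by
    intro v
    by_cases hv : ‖v‖ ≤ r
    · obtain ⟨x, hxS, hx⟩ := hdense v hv
      exact ⟨x, fun _ ↦ ⟨hxS, hx⟩⟩
    · obtain ⟨x, hxS, -⟩ := hdense 0 (by simpa using hr.le)
      exact ⟨x, fun h' ↦ (hv h').elim⟩
  choose ψ hψ using hch
  -- the transition map `F = φ₂ ∘ ψ` is a `4δ`-isometry of the closed ball
  set F : EuclideanSpace ℝ (Fin n) → EuclideanSpace ℝ (Fin n) := fun v ↦ φ₂ (ψ v) with hF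
  have hF : ∀ v w : EuclideanSpace ℝ (Fin n), ‖v‖ ≤ r → ‖w‖ ≤ r → |‖F v - F w‖ - ‖v - w‖| ≤ 4 * δ := by
    intro v w hv hw
    obtain ⟨hvS, hvd⟩ := hψ v hv
    obtain ⟨hwS, hwd⟩ := hψ w hw
    have a := h₂ (ψ v) hvS (ψ w) hwS
    have b := h₁ (ψ v) hvS (ψ w) hwS
    -- `|‖φ₁ψv - φ₁ψw‖ - ‖v - w‖| ≤ 2δ`
    have c : |‖φ₁ (ψ v) - φ₁ (ψ w)‖ - ‖v - w‖| ≤ 2 * δ := by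
      have e : φ₁ (ψ v) - φ₁ (ψ w) = (v - w) + ((φ₁ (ψ v) - v) - (φ₁ (ψ w) - w)) := by abel
      rw [abs_le]
      constructor
      · have := norm_sub_norm_le (φ₁ (ψ v) - φ₁ (ψ w)) (v - w)
        have h3 : ‖(v - w) - (φ₁ (ψ v) - φ₁ (ψ w))‖ ≤ 2 * δ := by
          calc ‖(v - w) - (φ₁ (ψ v) - φ₁ (ψ w))‖ = ‖(φ₁ (ψ w) - w) - (φ₁ (ψ v) - v)‖ := by
                congr 1; abel
            _ ≤ ‖φ₁ (ψ w) - w‖ + ‖φ₁ (ψ v) - v‖ := norm_sub_le _ _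
            _ ≤ 2 * δ := by linarith
        have := abs_norm_sub_norm_le (v - w) (φ₁ (ψ v) - φ₁ (ψ w))
        rw [abs_le] at this
        linarith [this.1, this.2]
      · calc ‖φ₁ (ψ v) - φ₁ (ψ w)‖ - ‖v - w‖ ≤ ‖(φ₁ (ψ v) - v) - (φ₁ (ψ w) - w)‖ := by
              rw [e]; linarith [norm_add_le (v - w) ((φ₁ (ψ v) - v) - (φ₁ (ψ w) - w))]
          _ ≤ ‖φ₁ (ψ v) - v‖ + ‖φ₁ (ψ w) - w‖ := norm_sub_le _ _
          _ ≤ 2 * δ := by linarith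
    rw [abs_le] at a b c ⊢
    constructor <;> linarith [a.1, a.2, b.1, b.2, c.1, c.2]
  -- the near-isometry lemma for `F`
  obtain ⟨A, hA⟩ := exists_linearIsometryEquiv_near_of_abs_norm_sub_le_of_radius n hr F (by linarith) hδ hF
  refine ⟨F 0, A, fun x hxS hx ↦ ?_⟩
  -- compare `φ₂ x` with `F (φ₁ x) = φ₂ (ψ (φ₁ x))`: `d(ψ(φ₁ x), x) ≤ 2δ`
  obtain ⟨hyS, hyd⟩ := hψ (φ₁ x) hx
  have hd : dist (ψ (φ₁ x)) x ≤ 2 * δ := by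
    have b := h₁ (ψ (φ₁ x)) hyS x hxS
    rw [abs_le] at b
    linarith [b.1, b.2]
  have h3 : ‖φ₂ x - F (φ₁ x)‖ ≤ 3 * δ := by
    have a := h₂ x hxS (ψ (φ₁ x)) hyS
    rw [abs_le] at a
    rw [dist_comm] at hd
    show ‖φ₂ x - φ₂ (ψ (φ₁ x))‖ ≤ 3 * δ
    linarith [a.1, a.2]
  have h4 := hA (φ₁ x) hx
  calc ‖φ₂ x - (F 0 + A (φ₁ x))‖ ≤ ‖φ₂ x - F (φ₁ x)‖ + ‖F (φ₁ x) - (F 0 + A (φ₁ x))‖ :=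
        norm_sub_le_norm_sub_add_norm_sub _ _ _
    _ ≤ 3 * δ + n * (6 + 11 * (7 * n : ℝ) ^ n) * (4 * δ) := add_le_add h3 h4
    _ = (3 + 4 * (n * (6 + 11 * (7 * n : ℝ) ^ n))) * δ := by ring

end Literature.Geometry.Euclidean

end
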